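import Summits.AnomalousDissipation.AnomalousDissipation.Theses.KolmogorovPincer
import Summits.AnomalousDissipation.AnomalousDissipation.Theorems.KolmogorovPincerShearWitnessTools
import Summits.AnomalousDissipation.AnomalousDissipation.Theorems.KolmogorovPincerOnsagerPincerTG
import Literature.Analysis.FluidPDE.AlexakisDoeringInterpolation
import Literature.Analysis.FunctionSpaces.BesovDifference
import Literature.Analysis.FunctionSpaces.FlatTorus

/-!
# KolmogorovPincer — the Taylor-scale shear dial (closes the aside `TaylorShearWitness`, item 33119)

PORT BY NAME of the lens-1 g15 kernel `taylorShearDialTG_holds` / `taylorShearWitness_holds`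
(`run/shared/lean/pub/decomp-ad/decomp-ad-lens-1/g15/KolmogorovLagCut_v2.lean` §ShearWitness, 0 sorry, axioms standard;
critic CLEARED Option R 2026-08-30T12:35Z): with `c = 1/(10π)`, `K = ⌈ν^{-1/2}⌉`, `U = shear (K-1) 1 = (0,0,cos(2πK x₀))`
(the tree steady shear of `Theorems/TwohalfdNeg/Negative/LaminarShear`): `U` is a unit steady Stokes eigenmode, global
Leray–Hopf from rest-at-itself under the force `ν(2πK)²U`, `‖U‖_∞ ≤ 1`, dissipation `2π²νK² ∈ [2π², 8π²]`,
`ν^{1/2}[U]²_{B^{1/2}_{8/3,∞}} ≤ 10π` (rung 1/2 TRUE) while `ν^{1/4}[U]²_{B^{1/2}_{8/3,∞}} ≥ ν^{-1/4}/(10π)` (Y FALSE)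
and `[U]²_{B^{1/3}_{3,∞}} ≥ ν^{-1/3}/(10π)` (Z FALSE) — the E10a pricing witness: classical velocity-amplitude inputs
saturate at cap 1/2. The aside is never load-bearing (outside `closes`). [decomp-ad lens-1 g61 KP-PORT-3]
-/

set_option linter.dupNamespace false

noncomputable section

namespace Summit.AnomalousDissipation.AnomalousDissipation.Theorems.KolmogorovPincerTaylorShearWitness

open scoped BigOperators Topology Classical MeasureTheory InnerProductSpace
open Filter Set Function TopologicalSpace MeasureTheory
open scoped ENNReal NNReal ComplexConjugate
open UnitAddTorus
open Literature.Analysis.FunctionSpaces Literature.Analysis.FunctionSpaces.Torus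
open Literature.Analysis.FluidPDE Literature.Analysis.FluidPDE.Torus
open Summit.AnomalousDissipation.AnomalousDissipation.Theses
open Summit.AnomalousDissipation.AnomalousDissipation.Theorems.TwohalfdNeg.Negative
open Summit.AnomalousDissipation.AnomalousDissipation.Theorems.KolmogorovPincerShearWitnessTools
open Summit.AnomalousDissipation.AnomalousDissipation.Theorems.KolmogorovPincerIncrementPincerTG
  (eBesovSupSeminorm_one_two_le_sqrt_three)
open Summit.AnomalousDissipation.AnomalousDissipation.Theorems.KolmogorovPincerOnsagerPincerTG
  (eBesovSupSeminorm_floor_le_onsager)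

/-- **The Taylor-scale shear dial, kernel-certified**: the route aside `KolmogorovPincer.TaylorShearWitness` holds (g15 `taylorShearDialTG_holds`, ported by name). -/
theorem kolmogorovPincer_taylorShearWitness : KolmogorovPincer.TaylorShearWitness := by
  refine ⟨1 / (10 * Real.pi), by positivity, fun ν hν hν1 => ?_⟩
  have hπ := Real.pi_pos
  have hπ3 : (3 : ℝ) < Real.pi := Real.pi_gt_three
  -- the Taylor wavenumber `K = ⌈ν^{-1/2}⌉`
  obtain ⟨r, hr⟩ : ∃ r : ℝ, r = ν ^ (-(1 / 2) : ℝ) := ⟨_, rfl⟩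
  have hr0 : 0 < r := by rw [hr]; exact Real.rpow_pos_of_pos hν _
  have hνr2 : ν * r ^ 2 = 1 := by
    rw [hr, ← Real.rpow_natCast, ← Real.rpow_mul hν.le, Nat.cast_ofNat,
      show (-(1 / 2) : ℝ) * 2 = -1 by norm_num, Real.rpow_neg_one, mul_inv_cancel₀ hν.ne']
  have hνr : ν ^ (1 / 2 : ℝ) * r = 1 := by
    rw [hr, ← Real.rpow_add hν, show (1 / 2 : ℝ) + -(1 / 2) = 0 by norm_num, Real.rpow_zero]
  have hν4r : ν ^ (1 / 4 : ℝ) * r = ν ^ (-(1 / 4) : ℝ) := by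
    rw [hr, ← Real.rpow_add hν, show (1 / 4 : ℝ) + -(1 / 2) = -(1 / 4) by norm_num]
  have hrinv : r⁻¹ = ν ^ (1 / 2 : ℝ) := by
    rw [hr, Real.rpow_neg hν.le, inv_inv]
  have hνhalf1 : ν ^ (1 / 2 : ℝ) ≤ 1 := Real.rpow_le_one hν.le hν1.le (by norm_num)
  have hνr1 : ν * r ≤ 1 := by
    have h2 : (ν * r) ^ 2 ≤ 1 := by
      calc (ν * r) ^ 2 = ν * (ν * r ^ 2) := by ring
        _ = ν := by rw [hνr2, mul_one]
        _ ≤ 1 := hν1.le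
    exact (sq_le_one_iff₀ (by positivity)).1 h2
  set K : ℕ := ⌈r⌉₊ with hK
  have hrK : r ≤ (K : ℝ) := Nat.le_ceil r
  have hKr : (K : ℝ) ≤ r + 1 := (Nat.ceil_lt_add_one hr0.le).le
  have hK1 : 1 ≤ K := Nat.ceil_pos.2 hr0
  have hK0 : (0 : ℝ) < K := by exact_mod_cast hK1
  obtain ⟨n, hnK⟩ : ∃ n : ℕ, n + 1 = K := ⟨K - 1, Nat.sub_add_cancel hK1⟩
  have hnR : ((n : ℝ) + 1) = K := by exact_mod_cast hnK
  have hνK2_ge : 1 ≤ ν * (K : ℝ) ^ 2 := by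
    calc (1 : ℝ) = ν * r ^ 2 := hνr2.symm
      _ ≤ ν * (K : ℝ) ^ 2 := by gcongr
  have hνK2_le : ν * (K : ℝ) ^ 2 ≤ 4 := by
    calc ν * (K : ℝ) ^ 2 ≤ ν * (r + 1) ^ 2 := by gcongr
      _ = ν * r ^ 2 + 2 * (ν * r) + ν := by ring
      _ ≤ 4 := by rw [hνr2]; linarith
  -- the eigenmode `U = shear n 1 = (0,0,cos(2πK x₀))`
  have hUs : IsSmooth (shear n 1) := isSmooth_shear n 1
  have hU2 : MemLp (shear n 1) 2 volume := hUs.memLp 2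
  have hUae : AEStronglyMeasurable (shear n 1) volume := hU2.1
  have hUinf : eLpNorm (shear n 1) ⊤ volume ≤ 1 := (eLpNorm_top_shear_le n 1).trans (by simp)
  have hGreal : (eGradNormSq (shear n 1)).toReal = 2 * Real.pi ^ 2 * (K : ℝ) ^ 2 := by
    rw [toReal_eGradNormSq_shear, hnR]; ring
  have hGne : eGradNormSq (shear n 1) ≠ ⊤ := (eGradNormSq_lt_top hUs).ne
  have hG : eGradNormSq (shear n 1) = ENNReal.ofReal (2 * Real.pi ^ 2 * (K : ℝ) ^ 2) := by
    rw [← hGreal, ENNReal.ofReal_toReal hGne]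
  have hD : meanDissipation ν (fun _ => shear n 1) = 2 * Real.pi ^ 2 * (ν * (K : ℝ) ^ 2) := by
    rw [meanDissipation_shear, hnR]; ring
  -- UPPER Besov bound at (1/2, 8/3): `[U]⁴ ≤ 3‖∇U‖² · 4‖U‖_∞² ≤ 24π²K²`
  set B := eBesovSupSeminorm (1 / 2 : ℝ) (8 / 3 : ℝ≥0∞) (shear n 1) volume with hB
  have hB4 : B ^ 4 ≤ ENNReal.ofReal (24 * Real.pi ^ 2 * (K : ℝ) ^ 2) := by
    calc B ^ 4 ≤ 3 * eGradNormSq (shear n 1) * (4 * eLpNorm (shear n 1) ⊤ volume ^ 2) :=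
          eBesovSupSeminorm_half_pow_four_le_linfty hU2
      _ ≤ 3 * eGradNormSq (shear n 1) * (4 * 1 ^ 2) := by gcongr
      _ = ENNReal.ofReal (24 * Real.pi ^ 2 * (K : ℝ) ^ 2) := by
          rw [hG, one_pow, mul_one, show (3 : ℝ≥0∞) = ENNReal.ofReal 3 by norm_num,
            show (4 : ℝ≥0∞) = ENNReal.ofReal 4 by norm_num, ← ENNReal.ofReal_mul (by norm_num),
            ← ENNReal.ofReal_mul (by positivity)]
          congr 1
          ring
  have hBne : B ≠ ⊤ := by
    intro h
    rw [h] at hB4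
    simp at hB4
  have hYt0 : 0 ≤ (B ^ 2).toReal := ENNReal.toReal_nonneg
  have hYt2 : (B ^ 2).toReal ^ 2 ≤ 24 * Real.pi ^ 2 * (K : ℝ) ^ 2 := by
    calc (B ^ 2).toReal ^ 2 = (B ^ 4).toReal := by rw [← ENNReal.toReal_pow, ← pow_mul]
      _ ≤ 24 * Real.pi ^ 2 * (K : ℝ) ^ 2 := ENNReal.toReal_le_of_le_ofReal (by positivity) hB4
  have hYt : (B ^ 2).toReal ≤ 5 * Real.pi * K := by
    have h5 : (B ^ 2).toReal ^ 2 ≤ (5 * Real.pi * K) ^ 2 :=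
      hYt2.trans (by nlinarith [sq_nonneg (Real.pi * K)])
    exact (pow_le_pow_iff_left₀ hYt0 (by positivity) two_ne_zero).1 h5
  -- LOWER Besov bounds from the half-period increment `δ_{h₀} U = -2U`, `‖h₀‖ = 1/(2K)`
  have hh0 := single_halfPeriod_ne_zero n
  have hnorm : ‖(Pi.single (0 : Fin 3) ((halfPeriod n : ℝ) : UnitAddCircle) : UnitAddTorus (Fin 3))‖ =
      1 / (2 * (K : ℝ)) := by
    rw [norm_single_halfPeriod, halfPeriod_eq, hnR]
  have hp0 : 0 < 1 / (2 * (K : ℝ)) := by positivity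
  have hL2sq' : eLpNorm (shear n 1) 2 volume ^ 2 = 2⁻¹ := by
    rw [eLpNorm_two_shear_sq, one_pow, one_div, ENNReal.ofReal_inv_of_pos two_pos, ENNReal.ofReal_ofNat]
  have key : ∀ (s : ℝ) (p : ℝ≥0∞), 2 ≤ p →
      (2 : ℝ≥0∞) ≤ eBesovSupSeminorm s p (shear n 1) volume ^ 2 *
        ENNReal.ofReal ((1 / (2 * (K : ℝ))) ^ s) ^ 2 := by
    intro s p hp
    have hq : 2 * eLpNorm (shear n 1) p volume ≤
        eBesovSupSeminorm s p (shear n 1) volume * ENNReal.ofReal ((1 / (2 * (K : ℝ))) ^ s) := by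
      have := eLpNorm_sub_le_eBesovSupSeminorm_mul (s := s) (p := p) (f := shear n 1) (μ := volume) hh0
      rwa [eLpNorm_shear_sub_translate_halfPeriod, hnorm] at this
    have h2 : 2 * eLpNorm (shear n 1) 2 volume ≤
        eBesovSupSeminorm s p (shear n 1) volume * ENNReal.ofReal ((1 / (2 * (K : ℝ))) ^ s) :=
      le_trans (by gcongr; exact eLpNorm_le_eLpNorm_of_exponent_le hp hUae) hq
    calc (2 : ℝ≥0∞) = (2 * eLpNorm (shear n 1) 2 volume) ^ 2 := by
          rw [mul_pow, hL2sq', sq, mul_assoc, ENNReal.mul_inv_cancel two_ne_zero ENNReal.ofNat_ne_top,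
            mul_one]
      _ ≤ (eBesovSupSeminorm s p (shear n 1) volume * ENNReal.ofReal ((1 / (2 * (K : ℝ))) ^ s)) ^ 2 := by
          gcongr
      _ = _ := mul_pow _ _ _
  -- Y-jaw analogue: `[U]²_{B^{1/2}_{8/3,∞}} ≥ 4K`
  have h283 : (2 : ℝ≥0∞) ≤ 8 / 3 := by
    rw [ENNReal.le_div_iff_mul_le (by norm_num) (by norm_num)]; norm_num
  have hYlow : 4 * (K : ℝ) ≤ (B ^ 2).toReal := by
    have kY := key (1 / 2 : ℝ) (8 / 3 : ℝ≥0∞) h283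
    have hsq : ENNReal.ofReal ((1 / (2 * (K : ℝ))) ^ (1 / 2 : ℝ)) ^ 2 = ENNReal.ofReal (1 / (2 * K)) := by
      rw [← ENNReal.ofReal_pow (by positivity), ← Real.rpow_natCast, ← Real.rpow_mul hp0.le]
      norm_num
    rw [hsq] at kY
    have hfin : B ^ 2 * ENNReal.ofReal (1 / (2 * (K : ℝ))) ≠ ⊤ :=
      ENNReal.mul_ne_top (ENNReal.pow_ne_top hBne) ENNReal.ofReal_ne_top
    have h' := ENNReal.toReal_mono hfin kY
    rw [ENNReal.toReal_ofNat, ENNReal.toReal_mul, ENNReal.toReal_ofReal hp0.le, mul_one_div,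
      le_div_iff₀ (by positivity)] at h'
    linarith
  -- Onsager-corner analogue: `[U]²_{B^{1/3}_{3,∞}} ≥ 2 ν^{-1/3}`
  set B₃ := eBesovSupSeminorm (1 / 3 : ℝ) 3 (shear n 1) volume with hB₃
  have hB₃ne : B₃ ≠ ⊤ := by
    have h1 : eBesovSupSeminorm 1 2 (shear n 1) volume ≠ ⊤ :=
      ne_top_of_le_ne_top
        (ENNReal.mul_ne_top ENNReal.ofReal_ne_top (ENNReal.rpow_ne_top_of_nonneg (by norm_num) hGne))
        (eBesovSupSeminorm_one_two_le_sqrt_three hU2)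
    refine ne_top_of_le_ne_top ?_ (eBesovSupSeminorm_third_three_le_linfty hUae)
    exact ENNReal.mul_ne_top (ENNReal.rpow_ne_top_of_nonneg (by norm_num) h1)
      (ENNReal.rpow_ne_top_of_nonneg (by norm_num)
        (ENNReal.mul_ne_top ENNReal.ofNat_ne_top (ne_top_of_le_ne_top ENNReal.one_ne_top hUinf)))
  have hZlow : 2 * ν ^ (-(1 / 3) : ℝ) ≤ (B₃ ^ 2).toReal := by
    have kZ := key (1 / 3 : ℝ) 3 (by norm_num)
    have hsq : ENNReal.ofReal ((1 / (2 * (K : ℝ))) ^ (1 / 3 : ℝ)) ^ 2 =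
        ENNReal.ofReal ((1 / (2 * K)) ^ (2 / 3 : ℝ)) := by
      rw [← ENNReal.ofReal_pow (by positivity), ← Real.rpow_natCast, ← Real.rpow_mul hp0.le]
      norm_num
    rw [hsq] at kZ
    have hfin : B₃ ^ 2 * ENNReal.ofReal ((1 / (2 * (K : ℝ))) ^ (2 / 3 : ℝ)) ≠ ⊤ :=
      ENNReal.mul_ne_top (ENNReal.pow_ne_top hB₃ne) ENNReal.ofReal_ne_top
    have h' := ENNReal.toReal_mono hfin kZ
    rw [ENNReal.toReal_ofNat, ENNReal.toReal_mul, ENNReal.toReal_ofReal (by positivity)] at h'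
    have hsmall : (1 / (2 * (K : ℝ))) ^ (2 / 3 : ℝ) ≤ ν ^ (1 / 3 : ℝ) := by
      have hle : 1 / (2 * (K : ℝ)) ≤ r⁻¹ := by
        rw [← one_div r]
        exact one_div_le_one_div_of_le hr0 (by linarith)
      calc (1 / (2 * (K : ℝ))) ^ (2 / 3 : ℝ) ≤ (r⁻¹) ^ (2 / 3 : ℝ) :=
            Real.rpow_le_rpow hp0.le hle (by norm_num)
        _ = ν ^ (1 / 3 : ℝ) := by
            rw [hrinv, ← Real.rpow_mul hν.le, show (1 / 2 : ℝ) * (2 / 3) = 1 / 3 by norm_num]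
    have hZ0 : 0 ≤ (B₃ ^ 2).toReal := ENNReal.toReal_nonneg
    have h3 : 2 ≤ (B₃ ^ 2).toReal * ν ^ (1 / 3 : ℝ) := h'.trans (by gcongr)
    have hνν : ν ^ (1 / 3 : ℝ) * ν ^ (-(1 / 3) : ℝ) = 1 := by
      rw [← Real.rpow_add hν, show (1 / 3 : ℝ) + -(1 / 3) = 0 by norm_num, Real.rpow_zero]
    calc 2 * ν ^ (-(1 / 3) : ℝ) ≤ ((B₃ ^ 2).toReal * ν ^ (1 / 3 : ℝ)) * ν ^ (-(1 / 3) : ℝ) := by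
          gcongr
      _ = (B₃ ^ 2).toReal := by rw [mul_assoc, hνν, mul_one]
  have hc4 : 1 / (10 * Real.pi) ≤ 2 := by
    rw [div_le_iff₀ (by positivity)]; nlinarith
  -- ASSEMBLY
  refine ⟨K, shear n 1, ?_, ?_, isSmooth_shear n 1, isDivFree_shear n 1, hasZeroMean_shear n 1,
    ?_, hUinf, ?_, ?_, ?_, ?_, ?_⟩
  · rw [← hr]; exact hrK
  · rw [← hr]; exact hKr
  · -- global Leray–Hopf for the force `ν(2πK)² U = shear n (4π²(n+1)²ν·1)`
    have hforce : (fun _ : ℝ => (ν * (2 * Real.pi * (K : ℝ)) ^ 2) • shear n 1) =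
        fun _ : ℝ => shear n (4 * Real.pi ^ 2 * ((n : ℝ) + 1) ^ 2 * ν * 1) := by
      funext t
      rw [shear_const_mul, hnR]
      congr 1
      ring
    rw [hforce]
    exact isGlobalLerayHopf_shear n rfl
  · rw [hD]; nlinarith [mul_nonneg (sq_nonneg Real.pi) (sub_nonneg.2 hνK2_ge)]
  · rw [hD]; nlinarith [mul_nonneg (sq_nonneg Real.pi) (sub_nonneg.2 hνK2_le)]
  · -- grade-1/2 rung TRUE: `ν^{1/2}[U]² ≤ 5πν^{1/2}K ≤ 5π(1 + ν^{1/2}) ≤ 10π`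
    rw [longTimeAvgSup_const_fun, one_div (10 * Real.pi), inv_inv]
    calc ν ^ (1 / 2 : ℝ) * (B ^ 2).toReal ≤ ν ^ (1 / 2 : ℝ) * (5 * Real.pi * K) := by gcongr
      _ ≤ ν ^ (1 / 2 : ℝ) * (5 * Real.pi * (r + 1)) := by gcongr
      _ = 5 * Real.pi * (ν ^ (1 / 2 : ℝ) * r + ν ^ (1 / 2 : ℝ)) := by ring
      _ ≤ 5 * Real.pi * (1 + 1) := by rw [hνr]; gcongr
      _ = 10 * Real.pi := by ring
  · -- Y-jaw analogue FALSE: `ν^{1/4}[U]² ≥ 4ν^{1/4}K ≥ 4ν^{-1/4}`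
    rw [longTimeAvgSup_const_fun, ← hν4r]
    calc 1 / (10 * Real.pi) * (ν ^ (1 / 4 : ℝ) * r) ≤ 4 * (ν ^ (1 / 4 : ℝ) * r) := by
          gcongr; linarith
      _ = ν ^ (1 / 4 : ℝ) * (4 * r) := by ring
      _ ≤ ν ^ (1 / 4 : ℝ) * (4 * K) := by gcongr
      _ ≤ ν ^ (1 / 4 : ℝ) * (B ^ 2).toReal := by gcongr
  · -- Onsager-ceiling analogue FALSE: `[U]²_{B^{1/3}_{3,∞}} ≥ 2ν^{-1/3}`
    rw [longTimeAvgSup_const_fun]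
    calc 1 / (10 * Real.pi) * ν ^ (-(1 / 3) : ℝ) ≤ 2 * ν ^ (-(1 / 3) : ℝ) := by gcongr
      _ ≤ (B₃ ^ 2).toReal := hZlow


end Summit.AnomalousDissipation.AnomalousDissipation.Theorems.KolmogorovPincerTaylorShearWitness

end
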